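import Mathlib
import HarnessLib
import Summits.HubbardSuperconductivity.HubbardSuperconductivity.Theorems.WeakCouplingBCSDefsKlCertTPrime

/-!
# idea-1 round 6 (KL-MARGIN-SCAN, lens = anomaly) — STAGGERED SLAVING of the `t′` kernel effect

Sketch for the crux idea `staggered-slaving` attached (as item evidence) to
`Theses.WeakCouplingBCS.WcbcsKohnLuttingerB1g` (stmt-HubbardSuperconductivity-0158); readers of record HQ1 (ii)/(iii).

THE MEASURED ANOMALY (floats of margin-1 g14 `scan_float.json`, `(N, M) = (1024, 256)`, my arithmetic `calc6/slaving_law.py`):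
idea-2 r5's Blaschke transplant (`s = √(1 − t′μ)`, `μ̃ = (μ − 4t′)/s`) makes the Fermi-curve GEOMETRY of the `t′` cell that of
the nearest-neighbour band at level `μ̃`, exactly; the residual "kernel effect" on channel `χ` is the ratio
`R_χ = s · λ_χ^{t′}(μ) / λ_χ⁰(μ̃)`.  On the 35 clean scan cells (`t′ ∈ {−0.02, …, −0.30}`; NN reference interpolated inside the
certified `t′ = 0` column, van Hove cells excluded) `R_{B1g}` runs from `1.27` (far hole-pocket side, `(δ, t′) = (0.05, −0.3)`) down
to `0.32` (`t′ = −0.3` beyond the van Hove crossing) and CHANGES SIGN across `1` on the `M` side of every `t′` row — a sign change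
neither idea-2 (who disclaimed a residual law) nor any table version explains.

THE LEVER: ONE scalar slaves it.  With `Q = (π, π)` and the *staggered excess*
`E_Q(t′, μ) := s · χ₀^{t′}(Q; μ) − χ₀⁰(Q; μ̃)` (the `q → 0` value transplants exactly: `s · χ₀^{t′}(0; μ) = χ₀⁰(0; μ̃) = ρ⁰(μ̃)`,
so `E_Q` is the whole change of RKS's two-point `(Q, 0)` model of the d-wave coupling, arXiv:1002.0591 p. 7),
`sign(R_{B1g} − 1) = sign E_Q` on 34/35 cells (the miss at `|P_Q − 1| = 0.018`), Pearson `r = 0.88`, `R_{B1g} ≈ 0.31 + 0.67·P_Q`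
(`P_Q := s χ₀^{t′}(Q; μ)/χ₀⁰(Q; μ̃)`); `A2g` is slaved the same way (33/35), `B2g`/`A1g` ANTI-slaved (32/35, 32/35), the d-wave
MARGIN slaved (33/35, `r = 0.88`); the crossover `E_Q = 0` is the straight line `δ×(t′) ≈ 0.40 |t′|` (hot-spot gain below it,
nesting loss above it).  The incommensurate PEAK of `χ₀` does NOT slave anything (20/35).

v2 (00:55Z, after hubbard-klscan-crit-1's grade NEW-COMBINATION (located) KEEP with sharpenings S1–S3): window ∩ floated doping range
(S1), item threshold `η = 1/10` with the 5 % law kept as the non-item `KlStaggeredSlavingSharp → K1` (S2), K2′'s certified inputs named (S3).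

Typed below (defs only; nothing is asserted): §1 the transplant scalars (idea-2's `klS`/`klMuT` BY VALUE — cite theirs by name once
`Theorems/WeakCouplingBCSKlBlaschkeTransplant.lean` is in the tree), `Q`, the staggered excess `E_Q` and the d-wave kernel gain
`G := channelInf ε₀ μ̃ 1 B1g − s · channelInf ε_{t′} μ 1 B1g` (`G > 0 ⟺ R_{B1g} > 1`); §2 the crux items K1 `KlStaggeredSlaving`
(sign law on the scan window, 10 % threshold; the 5 % law K1♯ and K1-wide on the extrapolation box are typed, not items) and K2 `KlEighthLineNoKernelGain` (`G ≤ 0` on the two clean segments of the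
HQ1 (iii) line: `t′`'s d-wave boost at `δ = ⅛` is entirely geometric); §3 the PROVED `t′ = 0` degenerations (`s = 1`, `μ̃ = μ`,
`E_Q = G = 0`; K2 at `t′ = 0`), which fix orientation and show the statements are not junk-valued at the anchor.

Floats are floats: no number quoted in a docstring is asserted by any `def`; nothing here asserts a margin at `t′ ≠ 0`, anything
about `K₃`, the doping window of the thesis, or superconductivity (a Kohn–Luttinger `O(U²)` channel statement is not ODLRO).
-/

noncomputable section

set_option linter.dupNamespace false

namespace Summit.HubbardSuperconductivity.HubbardSuperconductivity.Theorems.KlStaggeredSlaving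

open Literature.MathematicalPhysics.QuantumLattice
open Summit.HubbardSuperconductivity.HubbardSuperconductivity.Theorems

/-! ### §1 Transplant scalars, the staggered excess and the d-wave kernel gain -/

/-- The Blaschke scale `s(t′, μ) = √(1 − t′μ)` of idea-2 r5 (`klS`, by value). [folklore] -/
def slvS (tp μ : ℝ) : ℝ := Real.sqrt (1 - tp * μ)

/-- The transplanted nearest-neighbour level `μ̃(t′, μ) = (μ − 4t′)/s` of idea-2 r5 (`klMuT`, by value): the `t′` Fermi curve at
level `μ` is the Blaschke image of the `t′ = 0` Fermi curve at level `μ̃`. [folklore] -/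
def slvMuT (tp μ : ℝ) : ℝ := (μ - 4 * tp) / slvS tp μ

/-- The antiferromagnetic wave vector `Q = (π, π)`. [cite: RaghuKivelsonScalapino2010, §III] -/
def slvQ : Momentum := WithLp.toLp 2 ![Real.pi, Real.pi]

/-- The staggered susceptibility of the `t′` cell, `χ₀^{t′}(Q; μ)`. [cite: RaghuKivelsonScalapino2010, §II (5)] -/
def slvChiQTP (tp μ : ℝ) : ℝ := lindhardFunction (squareDispersion 1 tp) μ slvQ

/-- The staggered susceptibility of the transplanted nearest-neighbour reference, `χ₀⁰(Q; μ̃)` (for the `t′ = 0` band this is the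
one-dimensional integral `∫_{|μ̃|}^{4} ρ₀(e)/e de`, since `ε₀(k + Q) = −ε₀(k)`). [cite: RaghuKivelsonScalapino2010, §II (5)] -/
def slvChiQNN (tp μ : ℝ) : ℝ := lindhardFunction (squareDispersion 1 0) (slvMuT tp μ) slvQ

/-- **Staggered excess** `E_Q(t′, μ) := s · χ₀^{t′}(Q; μ) − χ₀⁰(Q; μ̃)` — the change, across the transplant, of the
large-momentum-transfer leg of RKS's two-point model of the d-wave coupling (the `q = 0` leg `s·ρ^{t′}(μ) = ρ⁰(μ̃)` does not change).
Float: `E_Q > 0` exactly on the far hole-pocket side `δ < δ×(t′) ≈ 0.40|t′|` (hot-spot gain), `E_Q < 0` elsewhere (nesting loss).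
[cite: RaghuKivelsonScalapino2010, §III] -/
def slvStaggeredExcess (tp μ : ℝ) : ℝ := slvS tp μ * slvChiQTP tp μ - slvChiQNN tp μ

/-- **d-wave kernel gain** `G(t′, μ) := channelInf ε₀ μ̃ 1 B1g − s · channelInf ε_{t′} μ 1 B1g`.  Both bottoms are `≤ 0`; `G > 0` iff
the transplanted `t′` d-wave bottom is deeper than the nearest-neighbour one at the same geometry (`R_{B1g} > 1`), `G < 0` iff `t′`
costs d-wave strength beyond geometry.  At `U = 1` the `B1g` bottom carries no bare-`U` term (mean-zero channel).
[cite: RaghuKivelsonScalapino2010, §II (7), (13)] -/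
def slvDWaveKernelGain (tp μ : ℝ) : ℝ :=
  channelInf (squareDispersion 1 0) (slvMuT tp μ) 1 D4Irrep.B1g - slvS tp μ * channelInf (squareDispersion 1 tp) μ 1 D4Irrep.B1g

/-! ### §2 The crux items (OPEN; stated, not asserted) -/

/-- **Staggered slaving on a window** `W ⊆ (t′, μ)`-plane with relative threshold `η`: wherever the staggered excess is at least
`η · χ₀⁰(Q; μ̃)` in size (`|P_Q − 1| ≥ η`), the d-wave kernel gain has the SAME sign: `0 ≤ E_Q · G`. [folklore] -/
def KlStaggeredSlavingOn (W : Set (ℝ × ℝ)) (η : ℝ) : Prop :=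
  ∀ p ∈ W, η * slvChiQNN p.1 p.2 ≤ |slvStaggeredExcess p.1 p.2| →
    0 ≤ slvStaggeredExcess p.1 p.2 * slvDWaveKernelGain p.1 p.2

/-- **The scan window of record** (v2, after the critic's (S1)): the box `t′ ∈ [−3/10, 0]`, `μ ∈ [−131/100, −27/100]`,
van Hove distance `|μ − 4t′| ≥ 1/16`, transplanted level inside the certified `t′ = 0` column `2/25 ≤ |μ̃| ≤ 16/25`, INTERSECTED with
the floated doping range `δ(μ; t′) ∈ [1/20, 7/20]` (`klDopingOfMuTP`) — the box alone strictly contains the hull of the 35 clean cells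
(it has zero-support strips: `t′ = −3/10, δ < 1/20`; the whole `M` side of `t′ = −1/10`; `t′ = −3/10, δ > 7/20`); the doping conjunct
removes them.  Between grid rows/columns the statement interpolates (continuum window), as any typed law over floats must. [folklore] -/
def slvScanWindow : Set (ℝ × ℝ) :=
  {p | p.1 ∈ Set.Icc (-3/10 : ℝ) 0 ∧ p.2 ∈ Set.Icc (-131/100 : ℝ) (-27/100) ∧ 1/16 ≤ |p.2 - 4 * p.1| ∧
       2/25 ≤ |slvMuT p.1 p.2| ∧ |slvMuT p.1 p.2| ≤ 16/25 ∧ klDopingOfMuTP p.1 p.2 ∈ Set.Icc (1/20 : ℝ) (7/20)}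

/-- **The wide window** (EXTRAPOLATION box, one `t′` step and one van Hove notch beyond anything floated): `t′ ∈ [−7/20, 0]`,
`μ ∈ [−7/5, −1/20]`, `|μ − 4t′| ≥ 1/40` (the programme's VH exclusion), `2/25 ≤ |μ̃| ≤ 9/10` (the whole certified `t′ = 0` column).
It contains the scan window (`slvScanWindow_subset_wide`). [folklore] -/
def slvWideWindow : Set (ℝ × ℝ) :=
  {p | p.1 ∈ Set.Icc (-7/20 : ℝ) 0 ∧ p.2 ∈ Set.Icc (-7/5 : ℝ) (-1/20) ∧ 1/40 ≤ |p.2 - 4 * p.1| ∧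
       2/25 ≤ |slvMuT p.1 p.2| ∧ |slvMuT p.1 p.2| ≤ 9/10}

/-- **K1 «STAGGERED SLAVING»** (crux, rank 2 of the idea; v2 threshold after the critic's (S2)): the sign law with the 10 % threshold on
the scan window — float evidence: every clean cell with `|P_Q − 1| ≥ 0.10` obeys it with `|R_{B1g} − 1| ≥ 0.066` (34/35 overall; the single
miss at `|P_Q − 1| = 0.018`; at `η = 1/20` the `t′ = −3/10` crossover leaves an undecidable sliver `δ ∈ (0.106, 0.108)` on the interpolants,
inside the ±3 % systematic — that sharper law is `KlStaggeredSlavingSharp`, not an item). Why it might fail: `P_Q` is a point value at `Q` while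
the `B1g` pair density weighs a neighbourhood of `Q`; a narrow incommensurate ridge of `χ₀^{t′}` near `Q` could put point and average more than
10 % apart near the crossover line `δ ≈ 0.40|t′|`. (the card's own OPEN statement — no fact tag) -/
def KlStaggeredSlaving : Prop := KlStaggeredSlavingOn slvScanWindow (1/10)

/-- **K1♯** (the 5 % law of the first filing; NOT an item after (S2)): implies K1 (`klStaggeredSlaving_of_sharp`). (the card's own OPEN statement — no fact tag) -/
def KlStaggeredSlavingSharp : Prop := KlStaggeredSlavingOn slvScanWindow (1/20)

/-- **K1-wide** (the bolder extrapolation; NOT an item — stated so that a float beyond the grid has a typed target): the same sign law on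
the wide window. It implies K1 (`klStaggeredSlaving_of_wide`). (the card's own OPEN statement — no fact tag) -/
def KlStaggeredSlavingWide : Prop := KlStaggeredSlavingOn slvWideWindow (1/10)

/-- Monotonicity of the slaving law in the window. [folklore] -/
theorem klStaggeredSlavingOn_mono {W W' : Set (ℝ × ℝ)} {η : ℝ} (hW : W ⊆ W') (h : KlStaggeredSlavingOn W' η) :
    KlStaggeredSlavingOn W η :=
  fun p hp hη => h p (hW hp) hη

/-- Monotonicity of the slaving law in the threshold: a smaller `η` is a STRONGER law (uses `χ₀ ≥ 0`, `lindhardFunction_nonneg`). [folklore] -/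
theorem klStaggeredSlavingOn_mono_eta {W : Set (ℝ × ℝ)} {η η' : ℝ} (hη : η ≤ η') (h : KlStaggeredSlavingOn W η) :
    KlStaggeredSlavingOn W η' := by
  intro p hp hη'
  have hχ : 0 ≤ slvChiQNN p.1 p.2 := lindhardFunction_nonneg _ _ _
  exact h p hp (le_trans (mul_le_mul_of_nonneg_right hη hχ) hη')

/-- K1♯ implies K1. [folklore] -/
theorem klStaggeredSlaving_of_sharp (h : KlStaggeredSlavingSharp) : KlStaggeredSlaving :=
  klStaggeredSlavingOn_mono_eta (by norm_num) h

/-- The scan window lies inside the wide window. [folklore] -/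
theorem slvScanWindow_subset_wide : slvScanWindow ⊆ slvWideWindow := by
  rintro ⟨tp, μ⟩ ⟨⟨h1, h2⟩, ⟨h3, h4⟩, h5, h6, h7, -⟩
  refine ⟨⟨by linarith, h2⟩, ⟨by linarith, by linarith⟩, le_trans (by norm_num) h5, h6, le_trans h7 (by norm_num)⟩

/-- K1-wide implies K1. [folklore] -/
theorem klStaggeredSlaving_of_wide (h : KlStaggeredSlavingWide) : KlStaggeredSlaving :=
  klStaggeredSlavingOn_mono slvScanWindow_subset_wide h

/-- **K2 «NO KERNEL GAIN ON THE ⅛ LINE»** (crux, rank 3): on the two clean segments `t′ ∈ [−3/10, −11/50] ∪ [−2/25, 0]` of the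
HQ1 (iii) line `δ = ⅛` (the van Hove crossing `t′ ≈ −0.15` and its flanks excluded), `G(t′, μ(⅛; t′)) ≤ 0`: the transplanted `t′`
d-wave bottom is never deeper than the nearest-neighbour bottom at `μ̃` — `t′`'s celebrated boost of d-wave pairing at `δ = ⅛` is
ENTIRELY Fermi-curve geometry (`μ̃ → 0`, `s < 1`); the kernel proper costs 4–21 % (float `R_{B1g} = 0.96, 0.93, 0.92, 0.89` at
`t′ = −0.02…−0.08`; `0.79, 0.83, 0.86, 0.89, 0.91` at `t′ = −0.22…−0.30`). Why it might fail: at `t′ → 0⁻` the claim is the SIGN of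
the `O(t′)` term of `G` (float `|R − 1| = 0.04` at `t′ = −0.02`), decidable either way by a first-order formula. (the card's own OPEN statement — no fact tag) -/
def KlEighthLineNoKernelGain : Prop :=
  ∀ tp ∈ Set.Icc (-3/10 : ℝ) (-11/50) ∪ Set.Icc (-2/25 : ℝ) 0, slvDWaveKernelGain tp (klMuOfDopingTP tp (1/8)) ≤ 0

/-- **K2′ (the located, cell-wise form margin-1 can decide first)**: `G ≤ 0` at the funded certified cell `(δ, t′) = (⅛, −3/10)`
(float `R_{B1g} = 0.912`, `P_Q = 0.980`).  Certified inputs it needs (critic's (S3)): j320108's `B1g` interval at the cell AND a certified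
`t′ = 0` `B1g` value at `μ̃ = 0.2849` (PH level `−0.2849`, not a record cell; nearest record `δ = 0.15` at `μ = −0.29679`) or a
Lipschitz-in-`μ` bound bridging `0.012` in `μ`; float room `≈ 9 %`. (the card's own OPEN statement — no fact tag) -/
def KlNoKernelGainFundedCell : Prop := slvDWaveKernelGain (-3/10) (klMuOfDopingTP (-3/10) (1/8)) ≤ 0

/-- K2 contains the funded cell. [folklore] -/
theorem klEighthLineNoKernelGain_funded (h : KlEighthLineNoKernelGain) : KlNoKernelGainFundedCell :=
  h (-3/10) (Or.inl ⟨by norm_num, by norm_num⟩)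

/-! ### §3 PROVED degenerations at the anchor `t′ = 0` (orientation and non-vacuity checks) -/

/-- At `t′ = 0` the Blaschke scale is `1`. [folklore] -/
@[simp] theorem slvS_zero (μ : ℝ) : slvS 0 μ = 1 := by simp [slvS]

/-- At `t′ = 0` the transplanted level is the level itself. [folklore] -/
@[simp] theorem slvMuT_zero (μ : ℝ) : slvMuT 0 μ = μ := by simp [slvMuT]

/-- At `t′ = 0` the staggered excess vanishes. [folklore] -/
@[simp] theorem slvStaggeredExcess_zero (μ : ℝ) : slvStaggeredExcess 0 μ = 0 := by
  simp [slvStaggeredExcess, slvChiQTP, slvChiQNN]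

/-- At `t′ = 0` the d-wave kernel gain vanishes. [folklore] -/
@[simp] theorem slvDWaveKernelGain_zero (μ : ℝ) : slvDWaveKernelGain 0 μ = 0 := by
  simp [slvDWaveKernelGain]

/-- At `t′ = 0` every window point satisfies the slaving inequality with equality (`E_Q = G = 0`). [folklore] -/
theorem klStaggeredSlavingOn_tzero (W : Set (ℝ × ℝ)) (η : ℝ) (hW : ∀ p ∈ W, p.1 = 0) : KlStaggeredSlavingOn W η := by
  intro p hp _
  obtain ⟨a, μ⟩ := p
  have ha : a = 0 := hW _ hp
  subst ha
  simp

/-- The `t′ = 0` endpoint of K2 holds (with equality). [folklore] -/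
theorem klEighthLineNoKernelGain_at_zero : slvDWaveKernelGain 0 (klMuOfDopingTP 0 (1/8)) ≤ 0 := by simp

/-- `1 − t′μ > 0` on the scan window's parameter range (`t′ ≤ 0`, `μ < 0` would give `t′μ ≥ 0`; here the bound used is
`t′ ∈ [−7/20, 0]`, `μ ∈ [−7/5, −1/20]` ⇒ `t′μ ≤ 49/100`), so `s` is a genuine square root, `s > 0`. [folklore] -/
theorem slvS_pos_of_window {tp μ : ℝ} (htp : tp ∈ Set.Icc (-7/20 : ℝ) 0) (hμ : μ ∈ Set.Icc (-7/5 : ℝ) (-1/20)) :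
    0 < slvS tp μ := by
  obtain ⟨h1, h2⟩ := htp
  obtain ⟨h3, h4⟩ := hμ
  unfold slvS
  apply Real.sqrt_pos.mpr
  nlinarith

/-- The WIDE window is inhabited next to the funded cell by an explicit rational point: `(t′, μ) = (−3/10, −24/25)` (float
`μ(⅛; −0.3) = −0.9596`) — `|μ − 4t′| = 6/25`, `s = √(89/125) ∈ (4/5, 9/10)`, so `μ̃ = (6/25)/s ∈ (4/15, 3/10) ⊂ [2/25, 9/10]`.  (For the scan
window the same point satisfies every explicit conjunct — `slvScanWindow_box_at_funded` — and the doping conjunct `δ(−24/25; −3/10) ∈ [1/20, 7/20]`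
is the float `δ = 0.1252`, not provable by arithmetic.) [folklore] -/
theorem slvWideWindow_inhabited : ((-3/10 : ℝ), (-24/25 : ℝ)) ∈ slvWideWindow := by
  have hs_lo : (4/5 : ℝ) < slvS (-3/10) (-24/25) := by
    unfold slvS
    rw [show (1 - (-3/10 : ℝ) * (-24/25)) = 89/125 by norm_num]
    exact (Real.lt_sqrt (by norm_num)).mpr (by norm_num)
  have hs_hi : slvS (-3/10) (-24/25) < 9/10 := by
    unfold slvS
    rw [show (1 - (-3/10 : ℝ) * (-24/25)) = 89/125 by norm_num]
    exact (Real.sqrt_lt' (by norm_num)).mpr (by norm_num)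
  have hs_pos : (0 : ℝ) < slvS (-3/10) (-24/25) := lt_trans (by norm_num) hs_lo
  have hmut : slvMuT (-3/10) (-24/25) = (6/25) / slvS (-3/10) (-24/25) := by
    unfold slvMuT; norm_num
  have hmut_pos : 0 < slvMuT (-3/10) (-24/25) := by rw [hmut]; positivity
  have hmut_lo : (2/25 : ℝ) ≤ slvMuT (-3/10) (-24/25) := by
    rw [hmut, le_div_iff₀ hs_pos]; nlinarith
  have hmut_hi : slvMuT (-3/10) (-24/25) ≤ 9/10 := by
    rw [hmut, div_le_iff₀ hs_pos]; nlinarith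
  refine ⟨⟨by norm_num, by norm_num⟩, ⟨by norm_num, by norm_num⟩, ?_, ?_, ?_⟩
  · norm_num
  · rwa [abs_of_pos hmut_pos]
  · rwa [abs_of_pos hmut_pos]

/-- The explicit (box) conjuncts of the scan window hold at the same rational point (`μ̃ < 3/10 ≤ 16/25`, `|μ − 4t′| = 6/25 ≥ 1/16`);
membership proper additionally needs the float doping value. [folklore] -/
theorem slvScanWindow_box_at_funded :
    (-3/10 : ℝ) ∈ Set.Icc (-3/10 : ℝ) 0 ∧ (-24/25 : ℝ) ∈ Set.Icc (-131/100 : ℝ) (-27/100) ∧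
      (1/16 : ℝ) ≤ |(-24/25 : ℝ) - 4 * (-3/10)| ∧ 2/25 ≤ |slvMuT (-3/10) (-24/25)| ∧ |slvMuT (-3/10) (-24/25)| ≤ 16/25 := by
  obtain ⟨-, -, -, h6, h7⟩ := slvWideWindow_inhabited
  have hs_lo : (4/5 : ℝ) < slvS (-3/10) (-24/25) := by
    unfold slvS
    rw [show (1 - (-3/10 : ℝ) * (-24/25)) = 89/125 by norm_num]
    exact (Real.lt_sqrt (by norm_num)).mpr (by norm_num)
  have hs_pos : (0 : ℝ) < slvS (-3/10) (-24/25) := lt_trans (by norm_num) hs_lo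
  have hmut : slvMuT (-3/10) (-24/25) = (6/25) / slvS (-3/10) (-24/25) := by
    unfold slvMuT; norm_num
  have hmut_pos : 0 < slvMuT (-3/10) (-24/25) := by rw [hmut]; positivity
  have hmut_hi : slvMuT (-3/10) (-24/25) ≤ 16/25 := by
    rw [hmut, div_le_iff₀ hs_pos]; nlinarith
  refine ⟨⟨by norm_num, by norm_num⟩, ⟨by norm_num, by norm_num⟩, by norm_num, h6, ?_⟩
  rwa [abs_of_pos hmut_pos]

end Summit.HubbardSuperconductivity.HubbardSuperconductivity.Theorems.KlStaggeredSlaving
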